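import Summits.BirchSwinnertonDyer.Rank1Residual.X2.HidaLimitInputsInt
import Summits.BirchSwinnertonDyer.Rank1Residual.X2.SplitHalvesOnTreeInt
import HarnessLib

/-!
# Crux 4 `BSDpOnCellC` (stmt-BirchSwinnertonDyer-19034), line b1 (skeleton v7 `61c171a5`), stub `stub_c3`:
# ROAD H (the Hida-limit chain) INSTANTIATED AT THE X2 PAIR CURRENCY, BOTH SIGNS, over the wide receptacle
# `𝓞_{ℂ_p}⟦T⟧` (cell `bsd-eis`, seat `bsd-eis-c3h` g0; PROGRAMME PART 1b seat (6) of the cell's ACCEL-LIST)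

HONEST FRAMING (cell `bsd-eis`, run/shared/lean/pub/bsd-eis/): theorems only; nothing booked; X2 stays
CONSTRUCTION-SHAPED; no label or count moves; BSD is not proved by any of this. Every theorem below is
CONDITIONAL on hypothesis-shaped `@[conjecture]` predicates of the tree that are NOT in refereed print at a
residually reducible `p ‖ N`: road H's INPUTS `X2.HidaLimitInputsIntAt W p` (p431128; provenance Keller–Yin
arXiv:2402.12781v2 §5.1 (a)–(e) [PRE] + cgshw MEMO-8 ((d)∞) / MEMO-9 ((α)) + Castella JIMJ 19 (2020) §1.5
((b), rider `p ∤ h_K`)) or road H's OUTPUT `X2.HidaLimitRevDivOnTreeInt W p` (p429473), and Keller–Yin's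
D′ read in `𝓞_{ℂ_p}` (`X2.NonsplitMuLambdaOnTreeInt W p`, `X2.SplitMuLambdaOnTreeInt W p`; PREPRINT, the part
of [KellerYin2024] Thm. 5.1.3 that its text proves — bsd-eis-ky MEMO-2, referee PASS).

## What

The registered stub `stub_c3` of line b1 is the IMC atom at both signs over the wide receptacle:

  `(∀ W p, CellC W p → ¬ split → X2.NonsplitIMCEqOnTreeInt W p) ∧ (∀ W p, CellC W p → split → X2.SplitIMCEqOnTreeInt W p)`.

Road H is typed END TO END in the tree (cgshw MEMO-10): inputs `HidaLimitInputsIntAt` (sign-free) ⟹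
[pure algebra: the one-sided REVERSE congruence limit across `Λ → 𝓞_{ℂ_p}⟦T⟧`,
`HidaLimitAlgebra.C_pow_mul_map_mem_span_of_oneSided_congruences_int` (p430924) = Skinner, Pacific J. Math.
283 (2016) §3.1 run one-sidedly; analytic Krull `CpIntSeries.mem_span_of_forall_mem_sup_pow`] ⟹ output
`∃ a, p^a·F♭ ∈ (Q)` ⟹ [with D′: first unit coefficients of `F♭` and `Q` at the same index;
`CpIntSeries.span_singleton_eq_of_C_pow_mul_mem` (p420633)] ⟹ `Ch_Λ(X_ac^∅)·𝓞_{ℂ_p}⟦T⟧ = (Q)`. The tree had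
the ¬split glue from the INPUTS (`X2.nonsplitIMCEqOnTreeInt_of_hidaLimitInputsInt_of_muLambdaInt`, p431128)
and the split glue only from the OUTPUT (`X2.splitIMCEqOnTreeInt_of_hidaLimitRevDivInt_of_muLambdaInt`,
p432153). This file supplies:

* `splitIMCEqOnTreeInt_of_hidaLimitInputsInt_of_muLambdaInt` — the missing SPLIT-sign glue from road H's
  INPUTS (the inputs predicate is sign-free; the unit coefficient of `Q` that the analytic Krull step needs
  is D′♭ at the split sign);
* `stub_c3_of_hidaLimitInputsInt_of_muLambdaInt` — **the registered `stub_c3` signature VERBATIM** from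
  road H's inputs at every X2c pair and D′♭ at each sign (inputs-form);
* `stub_c3_of_hidaLimitRevDivInt_of_muLambdaInt` — the same from road H's OUTPUT predicate (output-form);
* `stub_c3_of_divInt_or_hidaLimitInputsInt_of_muLambdaInt` — either divisibility source per sign
  (Kolyvagin half `Nonsplit/SplitKolyvaginDivOnTreeInt`, road R-β, OR road H's inputs) with D′♭.

So in stub currency, for the item OWNER's `BSDpOnCellC_of`: `stub_c3 ⇐ [∀ X2c pairs: HidaLimitInputsIntAt]
∧ [∀ ¬split X2c: NonsplitMuLambdaOnTreeInt] ∧ [∀ split X2c: SplitMuLambdaOnTreeInt]` — KERNEL glue, NO c1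
residual at either sign, NO new `Prop` fact, NO instance, NO notation. What this is NOT: not a proof of any
road-H input nor of D′ (all PRE-tier / memo-level, typed and named as such); not the VALUE atom c2; not
CTL-split; not crux 3.

References: [KellerYin2024] §5.1 (a)–(e), Lemma 5.1.2, Thm. 5.1.3 = Thm. D, Thm. 3.0.8 (arXiv:2402.12781v2,
PRE); [Skinner2016PacificMC] §3.1 (p. 192); [Castella2020JIMJ] = arXiv:1410.6591 §1.5; [Hsieh2014] Thm. 1 and
p. 7 (the receptacle); [Washington1997] §7.1 Prop. 7.2; cell memos cgshw MEMO-8 v1.3 / MEMO-9 v1.3 / MEMO-10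
v1.1, bsd-eis-ky MEMO-2.
-/

set_option autoImplicit false
set_option linter.dupNamespace false

noncomputable section

open scoped Classical MatrixGroups ModularForm

open CongruenceSubgroup WeierstrassCurve NumberField IsDedekindDomain Field PowerSeries
  Literature.RingTheory.FittingIdeal
  Literature.NumberTheory.EllipticCurves Literature.NumberTheory.EllipticCurves.GreenbergSelmer
  Literature.NumberTheory.EllipticCurves.ModularForms
  Literature.NumberTheory.EllipticCurves.Rank1Residual
  Literature.NumberTheory.EllipticCurves.Rank1Residual.Typed
  Literature.NumberTheory.GaloisRepresentations Literature.NumberTheory.GaloisCohomology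
  Literature.NumberTheory.Automorphic
  Summit.BirchSwinnertonDyer.Rank1Residual.X11b.AcSelmer
  Summit.BirchSwinnertonDyer.Rank1Residual.X11b.Halves
  Summit.BirchSwinnertonDyer.Rank1Residual.X11b
  Summit.BirchSwinnertonDyer.Rank1Residual.X2

namespace Summit.BirchSwinnertonDyer.BirchSwinnertonDyer.Theorems

/-! ### §1 The split-sign glue from road H's INPUTS over the wide receptacle -/

section SplitGlue

variable {W : WeierstrassCurve ℚ} [W.IsElliptic] [W.IsGloballyMinimal] {p : ℕ} [Fact p.Prime]

omit [W.IsGloballyMinimal] in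
/-- **Road H closes c3s♭ from its INPUTS**: `X2.HidaLimitInputsIntAt W p` (sign-free member data +
finite-submodule bound) + `X2.SplitMuLambdaOnTreeInt W p` (Keller–Yin D′♭ at the SPLIT sign: `F♭` and `Q`
have their first unit coefficient at the same index) ⟹ `X2.SplitIMCEqOnTreeInt W p`
(`Ch_Λ(X_ac^∅)·𝓞_{ℂ_p}⟦T⟧ = (Q)` for every `𝓞_{ℂ_p}`-frame at every SPLIT X2c Heegner datum). The split twin
of `X2.nonsplitIMCEqOnTreeInt_of_hidaLimitInputsInt_of_muLambdaInt` (p431128), same algebra: the unit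
coefficient of `Q` serves the analytic Krull step (`X2.C_pow_mul_map_mem_of_memberDataInt`) and the
closing (`CpIntSeries.span_singleton_eq_of_C_pow_mul_mem`); `X_ac^∅` is finitely generated by the tree's
PROVED `XAc.module_finite_empty`. CONDITIONAL on the two typed hypotheses (PRE-tier); nothing booked.
[cite: KellerYin2024, Lemma 5.1.2, Thm. 5.1.3 and proof of Thm. 3.0.8 (arXiv:2402.12781v2)]
[cite: Skinner2016PacificMC, §3.1 (p. 192)] [cite: Washington1997, §7.1 Prop. 7.2] -/
theorem splitIMCEqOnTreeInt_of_hidaLimitInputsInt_of_muLambdaInt (hin : HidaLimitInputsIntAt W p)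
    (hmls : SplitMuLambdaOnTreeInt W p) : SplitIMCEqOnTreeInt W p := by
  intro N _ K _ _ Dt H ιK P hc hs hN hK hd4 hHN hLt hP hcM hPinf κ hκ γ _ 𝔭 h𝔭 he hf f hfW ι' hι'
    ΩK Ωp Q hΩK hΩp hQ
  obtain ⟨F, hF⟩ :=
    (charIdeal_isPrincipal_holds p (XAc (W.baseChange K) p κ 𝔭 ∅ γ)).principal
  have hchar : XAc.charIdeal (W.baseChange K) p κ 𝔭 ∅ γ = Ideal.span {F} := hF
  obtain ⟨⟨a, hfitt⟩, hmem⟩ := hin N K Dt H ιK P hc hN hK hd4 hHN hLt hP hcM hPinf κ hκ γ 𝔭 h𝔭 he hf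
    f hfW ι' hι' ΩK Ωp Q hΩK hΩp hQ F hchar
  obtain ⟨n, hFn, hQn⟩ := hmls N K Dt H ιK P hc hs hN hK hd4 hHN hLt hP hcM hPinf κ hκ γ 𝔭 h𝔭 he
    hf f hfW ι' hι' ΩK Ωp Q hΩK hΩp hQ F hchar
  haveI : Module.Finite (IwasawaAlgebra p) (XAc (W.baseChange K) p κ 𝔭 ∅ γ) :=
    XAc.module_finite_empty κ 𝔭 γ
  have ha : C (((p : ℕ) : 𝓞_ℂ_[p]) ^ a) * PowerSeries.map (R1.toCpInt p) F ∈
      Ideal.span ({Q} : Set (PowerSeries 𝓞_ℂ_[p])) :=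
    C_pow_mul_map_mem_of_memberDataInt hQn hfitt hmem
  unfold R1.IMCEqIntAt
  rw [hchar, Ideal.map_span, Set.image_singleton]
  exact (CpIntSeries.span_singleton_eq_of_C_pow_mul_mem ha hQn hFn).symm

omit [W.IsGloballyMinimal] in
/-- **The split IMC atom from either divisibility source**: `(c3s♭-div ∨ HidaLimitInputsInt) ∧ c3s♭-μλ ⟹
c3s♭` (the split twin of `X2.nonsplitIMCEqOnTreeInt_of_divInt_or_hidaLimitInputsInt_of_muLambdaInt`, p431128;
the Kolyvagin half through `X2.splitIMCEqOnTreeInt_of_divInt_of_muLambdaInt`, p432153). CONDITIONAL;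
nothing booked. [folklore] -/
theorem splitIMCEqOnTreeInt_of_divInt_or_hidaLimitInputsInt_of_muLambdaInt
    (h : SplitKolyvaginDivOnTreeInt W p ∨ HidaLimitInputsIntAt W p) (hmls : SplitMuLambdaOnTreeInt W p) :
    SplitIMCEqOnTreeInt W p := by
  rcases h with hd | hin
  · exact splitIMCEqOnTreeInt_of_divInt_of_muLambdaInt hd hmls
  · exact splitIMCEqOnTreeInt_of_hidaLimitInputsInt_of_muLambdaInt hin hmls

end SplitGlue

/-! ### §2 `stub_c3` of line b1 VERBATIM from road H at the X2 pair currency -/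

section StubC3

/-- **`stub_c3` (line b1, skeleton v7 `61c171a5`, crux 4 `BSDpOnCellC`) FROM ROAD H'S INPUTS + KELLER–YIN D′,
BOTH SIGNS.** Hypotheses, each an EXISTING hypothesis-shaped predicate of the tree instantiated at the X2
pair currency: `hin` — road H's inputs `X2.HidaLimitInputsIntAt W p` at every X2c pair [PRE-dependent:
KY §5.1 (a)–(e) + cgshw MEMO-8/MEMO-9 + Cas20 §1.5]; `hml` — D′♭ at the non-split pairs
(`X2.NonsplitMuLambdaOnTreeInt`); `hmls` — D′♭ at the split pairs (`X2.SplitMuLambdaOnTreeInt`) [both PRE: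
KY Thm. 5.1.3, the part D′ its text proves]. Conclusion: the registered signature of `stub_c3` VERBATIM —
`(∀ CellC ¬split → X2.NonsplitIMCEqOnTreeInt) ∧ (∀ CellC split → X2.SplitIMCEqOnTreeInt)`. Proof: the landed
¬split glue `X2.nonsplitIMCEqOnTreeInt_of_hidaLimitInputsInt_of_muLambdaInt` (p431128) and §1's split glue.
CONDITIONAL-RESULT (typed ≠ proved ≠ endorsed); nothing booked; no label or count moves.
[claim: KellerYin2024, status: under-review]
[cite: KellerYin2024, §5.1 (a)–(e), Lemma 5.1.2, Thm. 5.1.3 = Thm. D (arXiv:2402.12781v2)]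
[cite: Skinner2016PacificMC, §3.1 (p. 192)] [cite: Hsieh2014, Thm. 1 and p. 7 (arXiv:1112.1580) (the receptacle)] -/
theorem stub_c3_of_hidaLimitInputsInt_of_muLambdaInt
    (hin : ∀ (W : WeierstrassCurve ℚ) [W.IsElliptic] [W.IsGloballyMinimal] (p : ℕ) [Fact p.Prime],
      CellC W p → HidaLimitInputsIntAt W p)
    (hml : ∀ (W : WeierstrassCurve ℚ) [W.IsElliptic] [W.IsGloballyMinimal] (p : ℕ) [Fact p.Prime],
      CellC W p → ¬ W.HasSplitMultiplicativeReductionAtPrime p → NonsplitMuLambdaOnTreeInt W p)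
    (hmls : ∀ (W : WeierstrassCurve ℚ) [W.IsElliptic] [W.IsGloballyMinimal] (p : ℕ) [Fact p.Prime],
      CellC W p → W.HasSplitMultiplicativeReductionAtPrime p → SplitMuLambdaOnTreeInt W p) :
    (∀ (W : WeierstrassCurve ℚ) [W.IsElliptic] [W.IsGloballyMinimal] (p : ℕ) [Fact p.Prime],
      CellC W p → ¬ W.HasSplitMultiplicativeReductionAtPrime p → NonsplitIMCEqOnTreeInt W p) ∧
    (∀ (W : WeierstrassCurve ℚ) [W.IsElliptic] [W.IsGloballyMinimal] (p : ℕ) [Fact p.Prime],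
      CellC W p → W.HasSplitMultiplicativeReductionAtPrime p → SplitIMCEqOnTreeInt W p) :=
  ⟨fun W _ _ p _ hc hns =>
      nonsplitIMCEqOnTreeInt_of_hidaLimitInputsInt_of_muLambdaInt (hin W p hc) (hml W p hc hns),
    fun W _ _ p _ hc hs =>
      splitIMCEqOnTreeInt_of_hidaLimitInputsInt_of_muLambdaInt (hin W p hc) (hmls W p hc hs)⟩

/-- **`stub_c3` FROM ROAD H'S OUTPUT + KELLER–YIN D′, BOTH SIGNS (output-form).** As above with road H
entered through its sign-free OUTPUT predicate `X2.HidaLimitRevDivOnTreeInt W p` (p429473: `∃ a, p^a·F♭ ∈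
(Q)` for every frame and generator) at every X2c pair; glue `X2.nonsplitIMCEqOnTreeInt_of_hidaLimitRevDivInt_of_muLambdaInt`
(p429473) / `X2.splitIMCEqOnTreeInt_of_hidaLimitRevDivInt_of_muLambdaInt` (p432153). CONDITIONAL-RESULT;
nothing booked. [claim: KellerYin2024, status: under-review]
[cite: KellerYin2024, Lemma 5.1.2 and Thm. 5.1.3 = Thm. D (arXiv:2402.12781v2)] [cite: Washington1997, §7.1 Prop. 7.2] -/
theorem stub_c3_of_hidaLimitRevDivInt_of_muLambdaInt
    (hrev : ∀ (W : WeierstrassCurve ℚ) [W.IsElliptic] [W.IsGloballyMinimal] (p : ℕ) [Fact p.Prime],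
      CellC W p → HidaLimitRevDivOnTreeInt W p)
    (hml : ∀ (W : WeierstrassCurve ℚ) [W.IsElliptic] [W.IsGloballyMinimal] (p : ℕ) [Fact p.Prime],
      CellC W p → ¬ W.HasSplitMultiplicativeReductionAtPrime p → NonsplitMuLambdaOnTreeInt W p)
    (hmls : ∀ (W : WeierstrassCurve ℚ) [W.IsElliptic] [W.IsGloballyMinimal] (p : ℕ) [Fact p.Prime],
      CellC W p → W.HasSplitMultiplicativeReductionAtPrime p → SplitMuLambdaOnTreeInt W p) :
    (∀ (W : WeierstrassCurve ℚ) [W.IsElliptic] [W.IsGloballyMinimal] (p : ℕ) [Fact p.Prime],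
      CellC W p → ¬ W.HasSplitMultiplicativeReductionAtPrime p → NonsplitIMCEqOnTreeInt W p) ∧
    (∀ (W : WeierstrassCurve ℚ) [W.IsElliptic] [W.IsGloballyMinimal] (p : ℕ) [Fact p.Prime],
      CellC W p → W.HasSplitMultiplicativeReductionAtPrime p → SplitIMCEqOnTreeInt W p) :=
  ⟨fun W _ _ p _ hc hns =>
      nonsplitIMCEqOnTreeInt_of_hidaLimitRevDivInt_of_muLambdaInt (hrev W p hc) (hml W p hc hns),
    fun W _ _ p _ hc hs =>
      splitIMCEqOnTreeInt_of_hidaLimitRevDivInt_of_muLambdaInt (hrev W p hc) (hmls W p hc hs)⟩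

/-- **`stub_c3` FROM EITHER DIVISIBILITY SOURCE PER SIGN + KELLER–YIN D′.** At the non-split pairs
`(c3♭-div ∨ HidaLimitInputsInt)`, at the split pairs `(c3s♭-div ∨ HidaLimitInputsInt)` (Kolyvagin half = road
R-β, `X2.Nonsplit/SplitKolyvaginDivOnTreeInt`, [claim: Castella2024, status: under-review]; road H's inputs
as above), with D′♭ at each sign. CONDITIONAL-RESULT; nothing booked. [claim: KellerYin2024, status: under-review]
[cite: KellerYin2024, proof of Thm. 3.0.8 and Thm. 5.1.3 (arXiv:2402.12781v2)] [cite: Washington1997, §7.1 Prop. 7.2] -/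
theorem stub_c3_of_divInt_or_hidaLimitInputsInt_of_muLambdaInt
    (hn : ∀ (W : WeierstrassCurve ℚ) [W.IsElliptic] [W.IsGloballyMinimal] (p : ℕ) [Fact p.Prime],
      CellC W p → ¬ W.HasSplitMultiplicativeReductionAtPrime p →
        NonsplitKolyvaginDivOnTreeInt W p ∨ HidaLimitInputsIntAt W p)
    (hsd : ∀ (W : WeierstrassCurve ℚ) [W.IsElliptic] [W.IsGloballyMinimal] (p : ℕ) [Fact p.Prime],
      CellC W p → W.HasSplitMultiplicativeReductionAtPrime p →
        SplitKolyvaginDivOnTreeInt W p ∨ HidaLimitInputsIntAt W p)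
    (hml : ∀ (W : WeierstrassCurve ℚ) [W.IsElliptic] [W.IsGloballyMinimal] (p : ℕ) [Fact p.Prime],
      CellC W p → ¬ W.HasSplitMultiplicativeReductionAtPrime p → NonsplitMuLambdaOnTreeInt W p)
    (hmls : ∀ (W : WeierstrassCurve ℚ) [W.IsElliptic] [W.IsGloballyMinimal] (p : ℕ) [Fact p.Prime],
      CellC W p → W.HasSplitMultiplicativeReductionAtPrime p → SplitMuLambdaOnTreeInt W p) :
    (∀ (W : WeierstrassCurve ℚ) [W.IsElliptic] [W.IsGloballyMinimal] (p : ℕ) [Fact p.Prime],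
      CellC W p → ¬ W.HasSplitMultiplicativeReductionAtPrime p → NonsplitIMCEqOnTreeInt W p) ∧
    (∀ (W : WeierstrassCurve ℚ) [W.IsElliptic] [W.IsGloballyMinimal] (p : ℕ) [Fact p.Prime],
      CellC W p → W.HasSplitMultiplicativeReductionAtPrime p → SplitIMCEqOnTreeInt W p) :=
  ⟨fun W _ _ p _ hc hns =>
      nonsplitIMCEqOnTreeInt_of_divInt_or_hidaLimitInputsInt_of_muLambdaInt (hn W p hc hns)
        (hml W p hc hns),
    fun W _ _ p _ hc hs =>
      splitIMCEqOnTreeInt_of_divInt_or_hidaLimitInputsInt_of_muLambdaInt (hsd W p hc hs)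
        (hmls W p hc hs)⟩

end StubC3

end Summit.BirchSwinnertonDyer.BirchSwinnertonDyer.Theorems

end
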